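import Mathlib
import Summits.ValiantsHypothesis.ValiantsHypothesis.Theorems.NewtonUnitEquationsDissociatedUniformStubExposedGenericDirection

/-!
# The RANK LEMMA for Newton polygons — val-idea-34 g13 (crux `stmt-ValiantsHypothesis-5906` `TwoProducts`)

`nv D ≤ 4 · rank (coefficient matrix of D)` for every `D ∈ ℂ[x,y]`, and its corollaries for the onset class of
record (`RankThreeAffineLaw`, val-idea-35 g10, OPEN) and for `TwoProducts`-type tables.  See the module docstrings of
the sections and the companion memo `RankLemma-val-idea-34-g13.md`.  Nothing here closes 5906; VP ≠ VNP is NOT proved.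
-/

set_option linter.dupNamespace false
set_option linter.unusedVariables false

open scoped BigOperators Classical

namespace Summit.ValiantsHypothesis.ValiantsHypothesis.Cruxes.TwoProducts.ValIdea34g13

open MvPolynomial

abbrev Poly2 := MvPolynomial (Fin 2) ℂ
abbrev Poly3 := MvPolynomial (Fin 3) ℂ
abbrev Expo := Fin 2 →₀ ℕ

/-- Planar embedding of an exponent (verbatim `TwoProducts` / val-idea-35 g8–g10). -/
def emb : Expo → (Fin 2 → ℝ) := fun e i => ((e i : ℕ) : ℝ)

/-- Number of vertices of the Newton polygon of `D` (verbatim `TwoProducts` / val-idea-35 g8–g10 `nv`). -/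
noncomputable def nv (D : Poly2) : ℕ :=
  (Set.extremePoints ℝ (convexHull ℝ (emb '' (D.support : Set Expo)))).ncard

/-! ## §1  Column records of a matrix: `|llCorner M| ≤ rank M` -/
section Records

variable {K : Type*} [Field K] {N : ℕ}

/-- The LOWER-LEFT CORNER SET of a square matrix: entries `(p,q)` with `M p q ≠ 0`, nothing to the left of it in
row `p` and nothing below it in column `q`. -/
noncomputable def llCorner (M : Matrix (Fin N) (Fin N) K) : Finset (Fin N × Fin N) :=
  Finset.univ.filter fun pq => M pq.1 pq.2 ≠ 0 ∧ (∀ q', q' < pq.2 → M pq.1 q' = 0) ∧ (∀ p', p' < pq.1 → M p' pq.2 = 0)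

theorem mem_llCorner {M : Matrix (Fin N) (Fin N) K} {pq : Fin N × Fin N} :
    pq ∈ llCorner M ↔ M pq.1 pq.2 ≠ 0 ∧ (∀ q', q' < pq.2 → M pq.1 q' = 0) ∧ (∀ p', p' < pq.1 → M p' pq.2 = 0) := by
  simp [llCorner]

/-- Span of the columns of index `< n`. -/
noncomputable def colSpan (M : Matrix (Fin N) (Fin N) K) (n : ℕ) : Submodule K (Fin N → K) :=
  Submodule.span K (M.col '' {q : Fin N | (q : ℕ) < n})

theorem colSpan_mono (M : Matrix (Fin N) (Fin N) K) {n n' : ℕ} (h : n ≤ n') : colSpan M n ≤ colSpan M n' :=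
  Submodule.span_mono (Set.image_mono fun q (hq : (q : ℕ) < n) => lt_of_lt_of_le hq h)

theorem col_mem_colSpan (M : Matrix (Fin N) (Fin N) K) (q : Fin N) {n : ℕ} (h : (q : ℕ) < n) :
    M.col q ∈ colSpan M n :=
  Submodule.subset_span ⟨q, h, rfl⟩

/-- `q` is a COLUMN RECORD of `M`: column `q` is not in the span of the columns to its left. -/
def IsColRecord (M : Matrix (Fin N) (Fin N) K) (q : Fin N) : Prop := M.col q ∉ colSpan M q

/-- The chain count: records of index `< n` number at most `dim (span of the columns of index < n)`. -/
theorem card_records_lt_le (M : Matrix (Fin N) (Fin N) K) (n : ℕ) :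
    (Finset.univ.filter fun q : Fin N => IsColRecord M q ∧ (q : ℕ) < n).card
      ≤ Module.finrank K (colSpan M n) := by
  induction n with
  | zero => simp
  | succ n ih =>
    by_cases hn : n < N
    · set qn : Fin N := ⟨n, hn⟩ with hqn
      have hsplit : (Finset.univ.filter fun q : Fin N => IsColRecord M q ∧ (q : ℕ) < n + 1)
          ⊆ (Finset.univ.filter fun q : Fin N => IsColRecord M q ∧ (q : ℕ) < n)
            ∪ (Finset.univ.filter fun q : Fin N => IsColRecord M q ∧ q = qn) := by
        intro q
        simp only [Finset.mem_filter, Finset.mem_union, Finset.mem_univ, true_and]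
        rintro ⟨hr, hlt⟩
        rcases Nat.lt_succ_iff_lt_or_eq.1 hlt with h | h
        · exact Or.inl ⟨hr, h⟩
        · exact Or.inr ⟨hr, Fin.ext h⟩
      have hone : (Finset.univ.filter fun q : Fin N => IsColRecord M q ∧ q = qn).card ≤ 1 := by
        refine (Finset.card_le_card (t := {qn}) ?_).trans (by simp)
        intro q
        simp only [Finset.mem_filter, Finset.mem_univ, true_and, Finset.mem_singleton]
        exact fun h => h.2
      have hmono : Module.finrank K (colSpan M n) ≤ Module.finrank K (colSpan M (n + 1)) :=
        Submodule.finrank_mono (colSpan_mono M (Nat.le_succ n))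
      by_cases hrec : IsColRecord M qn
      · have hlt : colSpan M n < colSpan M (n + 1) := by
          refine lt_of_le_of_ne (colSpan_mono M (Nat.le_succ n)) fun heq => hrec ?_
          have hmem : M.col qn ∈ colSpan M (n + 1) := col_mem_colSpan M qn (Nat.lt_succ_self n)
          rw [← heq] at hmem
          exact hmem
        have hfr := Submodule.finrank_lt_finrank_of_lt hlt
        calc (Finset.univ.filter fun q : Fin N => IsColRecord M q ∧ (q : ℕ) < n + 1).card
            ≤ (Finset.univ.filter fun q : Fin N => IsColRecord M q ∧ (q : ℕ) < n).card
              + (Finset.univ.filter fun q : Fin N => IsColRecord M q ∧ q = qn).card :=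
              (Finset.card_le_card hsplit).trans (Finset.card_union_le _ _)
          _ ≤ Module.finrank K (colSpan M n) + 1 := add_le_add ih hone
          _ ≤ Module.finrank K (colSpan M (n + 1)) := hfr
      · have hzero : (Finset.univ.filter fun q : Fin N => IsColRecord M q ∧ q = qn).card = 0 := by
          rw [Finset.card_eq_zero, Finset.filter_eq_empty_iff]
          rintro q - ⟨hr, rfl⟩
          exact hrec hr
        calc (Finset.univ.filter fun q : Fin N => IsColRecord M q ∧ (q : ℕ) < n + 1).card
            ≤ (Finset.univ.filter fun q : Fin N => IsColRecord M q ∧ (q : ℕ) < n).card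
              + (Finset.univ.filter fun q : Fin N => IsColRecord M q ∧ q = qn).card :=
              (Finset.card_le_card hsplit).trans (Finset.card_union_le _ _)
          _ ≤ Module.finrank K (colSpan M n) + 0 := add_le_add ih hzero.le
          _ ≤ Module.finrank K (colSpan M (n + 1)) := by simpa using hmono
    · have heq : (Finset.univ.filter fun q : Fin N => IsColRecord M q ∧ (q : ℕ) < n + 1)
          = (Finset.univ.filter fun q : Fin N => IsColRecord M q ∧ (q : ℕ) < n) := by
        ext q
        simp only [Finset.mem_filter, Finset.mem_univ, true_and]
        exact ⟨fun h => ⟨h.1, lt_of_lt_of_le q.isLt (not_lt.1 hn)⟩, fun h => ⟨h.1, Nat.lt_succ_of_lt h.2⟩⟩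
      rw [heq]
      exact ih.trans (Submodule.finrank_mono (colSpan_mono M (Nat.le_succ n)))

/-- Column records number at most `rank M`. -/
theorem card_records_le_rank (M : Matrix (Fin N) (Fin N) K) :
    (Finset.univ.filter fun q : Fin N => IsColRecord M q).card ≤ M.rank := by
  have h1 : (Finset.univ.filter fun q : Fin N => IsColRecord M q)
      = (Finset.univ.filter fun q : Fin N => IsColRecord M q ∧ (q : ℕ) < N) := by
    ext q; simp
  have h2 : colSpan M N = Submodule.span K (Set.range M.col) := by
    unfold colSpan; congr 1; ext v; constructor
    · rintro ⟨q, -, rfl⟩; exact ⟨q, rfl⟩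
    · rintro ⟨q, rfl⟩; exact ⟨q, q.isLt, rfl⟩
  rw [h1, Matrix.rank_eq_finrank_span_cols, ← h2]
  exact card_records_lt_le M N

/-- A lower-left corner in column `q` makes `q` a column record (the row-`p` coordinate functional vanishes on the
earlier columns but not on column `q`). -/
theorem isColRecord_of_mem_llCorner {M : Matrix (Fin N) (Fin N) K} {pq : Fin N × Fin N} (h : pq ∈ llCorner M) :
    IsColRecord M pq.2 := by
  obtain ⟨hne, hrow, -⟩ := mem_llCorner.1 h
  intro hmem
  have hle : colSpan M pq.2 ≤ LinearMap.ker (LinearMap.proj pq.1 : (Fin N → K) →ₗ[K] K) := by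
    refine Submodule.span_le.2 ?_
    rintro v ⟨q', hq', rfl⟩
    simp only [SetLike.mem_coe, LinearMap.mem_ker, LinearMap.proj_apply]
    exact hrow q' hq'
  have := hle hmem
  simp only [LinearMap.mem_ker, LinearMap.proj_apply] at this
  exact hne this

/-- **§1 main.** `|llCorner M| ≤ rank M`. -/
theorem card_llCorner_le_rank (M : Matrix (Fin N) (Fin N) K) : (llCorner M).card ≤ M.rank := by
  have hinj : Set.InjOn Prod.snd (llCorner M : Set (Fin N × Fin N)) := by
    rintro ⟨p, q⟩ hpq ⟨p', q'⟩ hpq' (hq : q = q')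
    subst hq
    obtain ⟨hne, -, hcol⟩ := mem_llCorner.1 (Finset.mem_coe.1 hpq)
    obtain ⟨hne', -, hcol'⟩ := mem_llCorner.1 (Finset.mem_coe.1 hpq')
    rcases lt_trichotomy p p' with h | h | h
    · exact absurd (hcol' p h) hne
    · rw [h]
    · exact absurd (hcol p' h) hne'
  calc (llCorner M).card = ((llCorner M).image Prod.snd).card := (Finset.card_image_of_injOn hinj).symm
    _ ≤ (Finset.univ.filter fun q : Fin N => IsColRecord M q).card := by
        refine Finset.card_le_card ?_
        intro q hq
        obtain ⟨pq, hpq, rfl⟩ := Finset.mem_image.1 hq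
        simpa using isColRecord_of_mem_llCorner hpq
    _ ≤ M.rank := card_records_le_rank M

end Records

/-! ## §2  From vertices of the Newton polygon to corners of the coefficient matrix

Dictionary: `coeffMatrix N D p q = coeff (x^p y^q) D`.  A vertex `e₀` of `Newt D` is the STRICT maximiser over
`supp D` of a height `ht w` with `w 0 ≠ 0 ≠ w 1` (generic exposing direction, Theorems
`stub_exposedGenericDirection`).  If `w 0 < 0` and `w 1 < 0` then every box point to the left of `e₀` in its row and
every box point below `e₀` in its column has larger-or-equal height, hence zero coefficient: `e₀` is a lower-left
corner of the matrix.  The other three sign patterns are lower-left corners of the row/column-reversed matrices,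
which have the same rank. -/
section Geometry

/-- Height of an exponent in direction `w`. -/
noncomputable def ht (w : Fin 2 → ℝ) (e : Expo) : ℝ := ∑ i, w i * ((e i : ℕ) : ℝ)

theorem ht_eq (w : Fin 2 → ℝ) (e : Expo) : ht w e = w 0 * ((e 0 : ℕ) : ℝ) + w 1 * ((e 1 : ℕ) : ℝ) := by
  simp [ht, Fin.sum_univ_two]

theorem emb_injective : Function.Injective emb := by
  intro p q hpq
  ext i
  have h := congr_fun hpq i
  simp only [emb] at h
  exact_mod_cast h

theorem expo_eq (e : Expo) : e = Finsupp.single 0 (e 0) + Finsupp.single 1 (e 1) := by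
  ext i
  fin_cases i <;> simp

/-- The exponent `x^p y^q`. -/
noncomputable def bx (p q : ℕ) : Expo := Finsupp.single 0 p + Finsupp.single 1 q

@[simp] theorem bx_zero (p q : ℕ) : bx p q 0 = p := by simp [bx]
@[simp] theorem bx_one (p q : ℕ) : bx p q 1 = q := by simp [bx]

theorem bx_apply_eq (e : Expo) : bx (e 0) (e 1) = e := (expo_eq e).symm

/-- Coefficient matrix of `D` on the box `[0,N)²`. -/
noncomputable def coeffMatrix (N : ℕ) (D : Poly2) : Matrix (Fin N) (Fin N) ℂ :=
  fun p q => MvPolynomial.coeff (bx p q) D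

/-- `D` is supported in the box `[0,N)²`. -/
def InBox (N : ℕ) (D : Poly2) : Prop := ∀ e ∈ D.support, e 0 < N ∧ e 1 < N

theorem inBox_of_le {N N' : ℕ} {D : Poly2} (h : InBox N D) (hN : N ≤ N') : InBox N' D :=
  fun e he => ⟨lt_of_lt_of_le (h e he).1 hN, lt_of_lt_of_le (h e he).2 hN⟩

/-- A canonical box: `N = 1 + max (e 0 + e 1)`. -/
noncomputable def boxSize (D : Poly2) : ℕ := (D.support.sup fun e => e 0 + e 1) + 1

theorem inBox_boxSize (D : Poly2) : InBox (boxSize D) D := by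
  intro e he
  have h : e 0 + e 1 ≤ D.support.sup (fun e : Expo => e 0 + e 1) :=
    Finset.le_sup (f := fun e : Expo => e 0 + e 1) he
  exact ⟨Nat.lt_succ_of_le (le_trans (Nat.le_add_right _ _) h),
    Nat.lt_succ_of_le (le_trans (Nat.le_add_left _ _) h)⟩

/-- `e₀` is the strict top of `supp D` in direction `w`. -/
def IsTop (D : Poly2) (w : Fin 2 → ℝ) (e₀ : Expo) : Prop := ∀ s ∈ D.support, s ≠ e₀ → ht w s < ht w e₀

theorem coeff_eq_zero_of_ht_le {D : Poly2} {e₀ : Expo} {w : Fin 2 → ℝ} (hw : IsTop D w e₀) {e : Expo}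
    (hne : e ≠ e₀) (hle : ht w e₀ ≤ ht w e) : MvPolynomial.coeff e D = 0 := by
  by_contra h
  exact absurd (hw e (MvPolynomial.mem_support_iff.2 h) hne) (not_lt.2 hle)

/-- Sign condition (`false`: negative, `true`: positive) and the matching reindexing of `Fin N`. -/
def sgnCond : Bool → ℝ → Prop
  | true, a => 0 < a
  | false, a => a < 0

/-- Identity or order reversal of `Fin N`. -/
def revIf (N : ℕ) : Bool → (Fin N ≃ Fin N)
  | true => Fin.revPerm
  | false => Equiv.refl _

theorem revIf_hyp {N : ℕ} (r : Bool) {a : ℝ} (ha : sgnCond r a) (p₀ i' : Fin N) (hi : i' < (revIf N r).symm p₀) :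
    ((revIf N r i' : Fin N) : ℕ) ≠ (p₀ : ℕ) ∧ 0 ≤ a * ((((revIf N r i' : Fin N) : ℕ) : ℝ) - ((p₀ : ℕ) : ℝ)) := by
  cases r with
  | false =>
    simp only [revIf, Equiv.refl_symm, Equiv.refl_apply] at hi ⊢
    simp only [sgnCond] at ha
    have hlt : (i' : ℕ) < (p₀ : ℕ) := hi
    refine ⟨by omega, le_of_lt (mul_pos_of_neg_of_neg ha (sub_neg.2 (by exact_mod_cast hlt)))⟩
  | true =>
    simp only [revIf, Fin.revPerm_symm, Fin.revPerm_apply] at hi ⊢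
    simp only [sgnCond] at ha
    have hlt' : p₀ < Fin.rev i' := Fin.lt_rev_iff.1 hi
    have hlt : (p₀ : ℕ) < ((Fin.rev i' : Fin N) : ℕ) := hlt'
    refine ⟨by omega, le_of_lt (mul_pos ha (sub_pos.2 (by exact_mod_cast hlt)))⟩

/-- **Corner lemma.** A strict top `e₀` with exposing direction of sign pattern `(rx, ry)` is a lower-left corner of
the `(rx, ry)`-reindexed coefficient matrix. -/
theorem mem_llCorner_of_isTop {N : ℕ} {D : Poly2} {e₀ : Expo} (he₀ : e₀ ∈ D.support) (h0 : e₀ 0 < N)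
    (h1 : e₀ 1 < N) {w : Fin 2 → ℝ} (hw : IsTop D w e₀) (rx ry : Bool) (hx : sgnCond rx (w 0))
    (hy : sgnCond ry (w 1)) :
    ((revIf N rx).symm ⟨e₀ 0, h0⟩, (revIf N ry).symm ⟨e₀ 1, h1⟩)
      ∈ llCorner ((coeffMatrix N D).submatrix (revIf N rx) (revIf N ry)) := by
  rw [mem_llCorner]
  refine ⟨?_, ?_, ?_⟩
  · simp only [Matrix.submatrix_apply, Equiv.apply_symm_apply, coeffMatrix]
    rw [bx_apply_eq e₀]
    exact MvPolynomial.mem_support_iff.1 he₀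
  · intro j' hj'
    obtain ⟨hne, hnn⟩ := revIf_hyp ry hy ⟨e₀ 1, h1⟩ j' hj'
    simp only [Matrix.submatrix_apply, Equiv.apply_symm_apply, coeffMatrix]
    apply coeff_eq_zero_of_ht_le hw
    · intro h
      apply hne
      have := congrArg (fun e : Expo => e 1) h
      simpa using this
    · rw [ht_eq, ht_eq]
      simp only [bx_zero, bx_one]
      simp only at hnn
      nlinarith [hnn]
  · intro i' hi'
    obtain ⟨hne, hnn⟩ := revIf_hyp rx hx ⟨e₀ 0, h0⟩ i' hi'
    simp only [Matrix.submatrix_apply, Equiv.apply_symm_apply, coeffMatrix]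
    apply coeff_eq_zero_of_ht_le hw
    · intro h
      apply hne
      have := congrArg (fun e : Expo => e 0) h
      simpa using this
    · rw [ht_eq, ht_eq]
      simp only [bx_zero, bx_one]
      simp only at hnn
      nlinarith [hnn]

/-- Vertex exponents of `D`. -/
noncomputable def vtx (D : Poly2) : Finset Expo :=
  D.support.filter fun e => emb e ∈ Set.extremePoints ℝ (convexHull ℝ (emb '' (D.support : Set Expo)))

theorem extremePoints_eq_image_vtx (D : Poly2) :
    Set.extremePoints ℝ (convexHull ℝ (emb '' (D.support : Set Expo))) = emb '' (vtx D : Set Expo) := by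
  ext x
  constructor
  · intro hx
    obtain ⟨e, he, rfl⟩ := extremePoints_convexHull_subset hx
    exact ⟨e, Finset.mem_filter.2 ⟨Finset.mem_coe.1 he, hx⟩, rfl⟩
  · rintro ⟨e, he, rfl⟩
    exact (Finset.mem_filter.1 he).2

theorem nv_eq_card_vtx (D : Poly2) : nv D = (vtx D).card := by
  rw [nv, extremePoints_eq_image_vtx, Set.ncard_image_of_injective _ emb_injective, Set.ncard_coe_finset]

/-- The class of vertices exposed by a direction of sign pattern `(rx, ry)`. -/
noncomputable def cls (D : Poly2) (rx ry : Bool) : Finset Expo :=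
  (vtx D).filter fun e₀ => ∃ w : Fin 2 → ℝ, IsTop D w e₀ ∧ sgnCond rx (w 0) ∧ sgnCond ry (w 1)

theorem sgnCond_of_ne_zero {a : ℝ} (ha : a ≠ 0) : sgnCond false a ∨ sgnCond true a := by
  rcases lt_or_gt_of_ne ha with h | h
  · exact Or.inl h
  · exact Or.inr h

/-- Every vertex is in one of the four classes (generic exposing direction). -/
theorem vtx_subset_union_cls (D : Poly2) :
    vtx D ⊆ ((cls D false false ∪ cls D true false) ∪ cls D false true) ∪ cls D true true := by
  classical
  intro e₀ he₀
  have hv := (Finset.mem_filter.1 he₀).2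
  obtain ⟨w, e₁, he₁S, he₁e, hstrict, hinjT⟩ :=
    Summit.ValiantsHypothesis.ValiantsHypothesis.Theorems.NewtonUnitEquationsDissociatedUniform.stub_exposedGenericDirection
      D.support ({0, Finsupp.single 0 1, Finsupp.single 1 1} : Finset Expo) (emb e₀) hv
  have he₁ : e₁ = e₀ := emb_injective he₁e
  subst he₁
  have htop : IsTop D w e₁ := fun s hs hne => by simpa [ht] using hstrict s hs hne
  have hw0 : w 0 ≠ 0 := by
    intro h0
    have h01 : (Finsupp.single 0 1 : Expo) ≠ 0 := by simp
    apply h01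
    apply hinjT (by simp) (by simp)
    simp [Fin.sum_univ_two, h0]
  have hw1 : w 1 ≠ 0 := by
    intro h1
    have h11 : (Finsupp.single 1 1 : Expo) ≠ 0 := by simp
    apply h11
    apply hinjT (by simp) (by simp)
    simp [Fin.sum_univ_two, h1]
  simp only [Finset.mem_union, cls, Finset.mem_filter]
  rcases sgnCond_of_ne_zero hw0 with h0 | h0 <;> rcases sgnCond_of_ne_zero hw1 with h1 | h1
  · exact Or.inl (Or.inl (Or.inl ⟨he₀, w, htop, h0, h1⟩))
  · exact Or.inl (Or.inr ⟨he₀, w, htop, h0, h1⟩)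
  · exact Or.inl (Or.inl (Or.inr ⟨he₀, w, htop, h0, h1⟩))
  · exact Or.inr ⟨he₀, w, htop, h0, h1⟩

/-- Reduction of a natural number into `Fin N` (identity below `N`). -/
def toFin (N : ℕ) [NeZero N] (k : ℕ) : Fin N := ⟨k % N, Nat.mod_lt _ (Nat.pos_of_ne_zero (NeZero.ne N))⟩

theorem toFin_eq {N : ℕ} [NeZero N] {k : ℕ} (h : k < N) : toFin N k = ⟨k, h⟩ :=
  Fin.ext (Nat.mod_eq_of_lt h)

/-- Each sign class injects into the corner set of the correspondingly reindexed matrix. -/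
theorem card_cls_le_rank {N : ℕ} [NeZero N] (D : Poly2) (hbox : InBox N D) (rx ry : Bool) :
    (cls D rx ry).card ≤ (coeffMatrix N D).rank := by
  classical
  set M := coeffMatrix N D with hM
  set ex := revIf N rx with hex
  set ey := revIf N ry with hey
  let Φ : Expo → Fin N × Fin N := fun e => (ex.symm (toFin N (e 0)), ey.symm (toFin N (e 1)))
  have hmaps : ∀ e ∈ cls D rx ry, Φ e ∈ llCorner (M.submatrix ex ey) := by
    intro e he
    obtain ⟨hev, w, htop, hx, hy⟩ := Finset.mem_filter.1 he
    have hes : e ∈ D.support := (Finset.mem_filter.1 hev).1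
    obtain ⟨h0, h1⟩ := hbox e hes
    have := mem_llCorner_of_isTop hes h0 h1 htop rx ry hx hy
    simp only [Φ, toFin_eq h0, toFin_eq h1]
    exact this
  have hinj : Set.InjOn Φ (cls D rx ry : Set Expo) := by
    intro e he e' he' hΦ
    have hes : e ∈ D.support := (Finset.mem_filter.1 (Finset.mem_filter.1 (Finset.mem_coe.1 he)).1).1
    have hes' : e' ∈ D.support := (Finset.mem_filter.1 (Finset.mem_filter.1 (Finset.mem_coe.1 he')).1).1
    obtain ⟨h0, h1⟩ := hbox e hes
    obtain ⟨h0', h1'⟩ := hbox e' hes'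
    simp only [Φ, Prod.mk.injEq, EmbeddingLike.apply_eq_iff_eq, toFin_eq h0, toFin_eq h1, toFin_eq h0',
      toFin_eq h1', Fin.mk.injEq] at hΦ
    rw [← bx_apply_eq e, ← bx_apply_eq e', hΦ.1, hΦ.2]
  calc (cls D rx ry).card ≤ (llCorner (M.submatrix ex ey)).card := Finset.card_le_card_of_injOn Φ hmaps hinj
    _ ≤ (M.submatrix ex ey).rank := card_llCorner_le_rank _
    _ = M.rank := Matrix.rank_submatrix M ex ey

/-- **RANK LEMMA.** The Newton polygon of `D ∈ ℂ[x,y]` has at most `4 · rank (coefficient matrix)` vertices. -/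
theorem nv_le_four_mul_rank (D : Poly2) (N : ℕ) (hbox : InBox N D) : nv D ≤ 4 * (coeffMatrix N D).rank := by
  classical
  rcases Nat.eq_zero_or_pos N with hN | hN
  · subst hN
    have hD : D.support = ∅ := by
      rw [Finset.eq_empty_iff_forall_notMem]
      intro e he
      exact absurd (hbox e he).1 (Nat.not_lt_zero _)
    have : vtx D = ∅ := by simp [vtx, hD]
    rw [nv_eq_card_vtx, this]
    simp
  · haveI : NeZero N := ⟨Nat.pos_iff_ne_zero.1 hN⟩
    rw [nv_eq_card_vtx]
    calc (vtx D).card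
        ≤ (((cls D false false ∪ cls D true false) ∪ cls D false true) ∪ cls D true true).card :=
          Finset.card_le_card (vtx_subset_union_cls D)
      _ ≤ (cls D false false).card + (cls D true false).card + (cls D false true).card
            + (cls D true true).card := by
          refine (Finset.card_union_le _ _).trans ?_
          refine add_le_add ((Finset.card_union_le _ _).trans (add_le_add (Finset.card_union_le _ _) le_rfl)) le_rfl
      _ ≤ (coeffMatrix N D).rank + (coeffMatrix N D).rank + (coeffMatrix N D).rank + (coeffMatrix N D).rank := by
          gcongr <;> exact card_cls_le_rank D hbox _ _
      _ = 4 * (coeffMatrix N D).rank := by ring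

end Geometry

/-! ## §3  Product form: `nv (Σ_{i ∈ I} Eᵢ(x) · Fᵢ(y)) ≤ 4 |I|`

The coefficient matrix of `E(x) · F(y)` is the rank-one matrix `(coeff x^p E) ⊗ (coeff y^q F)`; ranks are
subadditive. -/
section ProductForm

/-- `E` does not involve the variable `i` (`NoVar 1` = pure in `x`, `NoVar 0` = pure in `y`). -/
def NoVar (i : Fin 2) (E : Poly2) : Prop := ∀ e : Expo, e i ≠ 0 → MvPolynomial.coeff e E = 0

/-- `E ∈ ℂ[x]`. -/
abbrev PureX (E : Poly2) : Prop := NoVar 1 E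
/-- `F ∈ ℂ[y]`. -/
abbrev PureY (F : Poly2) : Prop := NoVar 0 F

theorem noVar_iff_support (i : Fin 2) (E : Poly2) : NoVar i E ↔ ∀ e ∈ E.support, e i = 0 := by
  constructor
  · intro h e he
    by_contra hne
    exact (MvPolynomial.mem_support_iff.1 he) (h e hne)
  · intro h e hne
    by_contra hc
    exact hne (h e (MvPolynomial.mem_support_iff.2 hc))

theorem noVar_zero (i : Fin 2) : NoVar i (0 : Poly2) := fun e _ => by simp

theorem noVar_C (i : Fin 2) (c : ℂ) : NoVar i (MvPolynomial.C c : Poly2) := by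
  intro e he
  rw [MvPolynomial.coeff_C]
  split_ifs with h
  · subst h; simp at he
  · rfl

theorem noVar_one (i : Fin 2) : NoVar i (1 : Poly2) := by
  simpa using noVar_C i 1

theorem noVar_natCast (i : Fin 2) (n : ℕ) : NoVar i (n : Poly2) := by
  rw [← map_natCast (MvPolynomial.C : ℂ →+* Poly2) n]
  exact noVar_C i n

theorem noVar_X {i j : Fin 2} (h : j ≠ i) : NoVar i (MvPolynomial.X j : Poly2) := by
  intro e he
  rw [MvPolynomial.coeff_X']
  split_ifs with hs
  · subst hs; simp [h] at he
  · rfl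

theorem noVar_add {i : Fin 2} {E E' : Poly2} (hE : NoVar i E) (hE' : NoVar i E') : NoVar i (E + E') := by
  intro e he
  rw [MvPolynomial.coeff_add, hE e he, hE' e he, add_zero]

theorem noVar_neg {i : Fin 2} {E : Poly2} (hE : NoVar i E) : NoVar i (-E) := by
  intro e he
  rw [MvPolynomial.coeff_neg, hE e he, neg_zero]

theorem noVar_sub {i : Fin 2} {E E' : Poly2} (hE : NoVar i E) (hE' : NoVar i E') : NoVar i (E - E') := by
  rw [sub_eq_add_neg]; exact noVar_add hE (noVar_neg hE')

theorem noVar_smul {i : Fin 2} {E : Poly2} (c : ℂ) (hE : NoVar i E) : NoVar i (c • E) := by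
  intro e he
  rw [MvPolynomial.coeff_smul, hE e he, smul_zero]

theorem noVar_mul {i : Fin 2} {E E' : Poly2} (hE : NoVar i E) (hE' : NoVar i E') : NoVar i (E * E') := by
  intro e he
  rw [MvPolynomial.coeff_mul]
  refine Finset.sum_eq_zero fun ab hab => ?_
  have hsum : ab.1 i + ab.2 i = e i := by
    have := congrArg (fun f : Expo => f i) (Finset.HasAntidiagonal.mem_antidiagonal.1 hab)
    simpa using this
  by_cases ha : ab.1 i = 0
  · have hb : ab.2 i ≠ 0 := by omega
    rw [hE' _ hb, mul_zero]
  · rw [hE _ ha, zero_mul]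

theorem noVar_sum {i : Fin 2} {ι : Type*} (s : Finset ι) (E : ι → Poly2) (h : ∀ x ∈ s, NoVar i (E x)) :
    NoVar i (∑ x ∈ s, E x) := by
  classical
  induction s using Finset.induction_on with
  | empty => simpa using noVar_zero i
  | insert a s ha ih =>
    rw [Finset.sum_insert ha]
    exact noVar_add (h a (Finset.mem_insert_self a s)) (ih fun x hx => h x (Finset.mem_insert_of_mem hx))

theorem noVar_prod {i : Fin 2} {ι : Type*} (s : Finset ι) (E : ι → Poly2) (h : ∀ x ∈ s, NoVar i (E x)) :
    NoVar i (∏ x ∈ s, E x) := by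
  classical
  induction s using Finset.induction_on with
  | empty => simpa using noVar_one i
  | insert a s ha ih =>
    rw [Finset.prod_insert ha]
    exact noVar_mul (h a (Finset.mem_insert_self a s)) (ih fun x hx => h x (Finset.mem_insert_of_mem hx))

theorem noVar_pow {i : Fin 2} {E : Poly2} (hE : NoVar i E) (n : ℕ) : NoVar i (E ^ n) := by
  induction n with
  | zero => simpa using noVar_one i
  | succ n ih => rw [pow_succ]; exact noVar_mul ih hE

/-- Coefficient of `x^p y^q` in `E(x) · F(y)`. -/
theorem coeff_bx_mul_of_pure {E F : Poly2} (hE : PureX E) (hF : PureY F) (p q : ℕ) :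
    MvPolynomial.coeff (bx p q) (E * F)
      = MvPolynomial.coeff (Finsupp.single 0 p) E * MvPolynomial.coeff (Finsupp.single 1 q) F := by
  rw [MvPolynomial.coeff_mul]
  have hmem : ((Finsupp.single 0 p : Expo), (Finsupp.single 1 q : Expo)) ∈ Finset.HasAntidiagonal.antidiagonal (bx p q) := by
    rw [Finset.HasAntidiagonal.mem_antidiagonal]; rfl
  rw [Finset.sum_eq_single_of_mem _ hmem]
  rintro ⟨a, b⟩ hab hne
  have hsum : a + b = bx p q := Finset.HasAntidiagonal.mem_antidiagonal.1 hab
  by_cases ha : a 1 = 0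
  · by_cases hb : b 0 = 0
    · exfalso
      apply hne
      have h0 := congrArg (fun f : Expo => f 0) hsum
      have h1 := congrArg (fun f : Expo => f 1) hsum
      simp only [Finsupp.coe_add, Pi.add_apply, bx_zero, bx_one, ha, hb, add_zero, zero_add] at h0 h1
      have haeq : a = Finsupp.single 0 p := by
        ext i; fin_cases i <;> simp [h0, ha]
      have hbeq : b = Finsupp.single 1 q := by
        ext i; fin_cases i <;> simp [h1, hb]
      rw [haeq, hbeq]
    · simp only
      rw [hF b hb, mul_zero]
  · simp only
    rw [hE a ha, zero_mul]

theorem coeffMatrix_mul_of_pure (N : ℕ) {E F : Poly2} (hE : PureX E) (hF : PureY F) :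
    coeffMatrix N (E * F) = Matrix.vecMulVec (fun p : Fin N => MvPolynomial.coeff (Finsupp.single 0 (p : ℕ)) E)
      (fun q : Fin N => MvPolynomial.coeff (Finsupp.single 1 (q : ℕ)) F) := by
  ext p q
  simp [coeffMatrix, Matrix.vecMulVec_apply, coeff_bx_mul_of_pure hE hF]

theorem coeffMatrix_sum (N : ℕ) {ι : Type*} (s : Finset ι) (G : ι → Poly2) :
    coeffMatrix N (∑ i ∈ s, G i) = ∑ i ∈ s, coeffMatrix N (G i) := by
  ext p q
  simp [coeffMatrix, MvPolynomial.coeff_sum, Matrix.sum_apply]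

/-- Rank is subadditive (folklore; the same 6-line proof as `Literature.Barriers.Schanuel.rank_add_le_rank_add_rank`,
copied to keep this workfile's imports minimal). -/
theorem rank_add_le {m n : Type*} [Fintype m] [Fintype n] (A B : Matrix m n ℂ) :
    (A + B).rank ≤ A.rank + B.rank := by
  unfold Matrix.rank
  rw [Matrix.mulVecLin_add]
  calc Module.finrank ℂ (LinearMap.range (A.mulVecLin + B.mulVecLin))
      ≤ Module.finrank ℂ ↥(LinearMap.range A.mulVecLin ⊔ LinearMap.range B.mulVecLin) := by
        apply Submodule.finrank_mono
        rintro _ ⟨v, rfl⟩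
        exact Submodule.add_mem_sup ⟨v, rfl⟩ ⟨v, rfl⟩
    _ ≤ _ := Submodule.finrank_add_le_finrank_add_finrank _ _

theorem rank_sum_le {m n : Type*} [Fintype m] [Fintype n] {ι : Type*} (s : Finset ι) (A : ι → Matrix m n ℂ) :
    (∑ i ∈ s, A i).rank ≤ ∑ i ∈ s, (A i).rank := by
  classical
  induction s using Finset.induction_on with
  | empty => simp [Matrix.rank_zero]
  | insert a s ha ih =>
    rw [Finset.sum_insert ha, Finset.sum_insert ha]
    exact (rank_add_le _ _).trans (add_le_add le_rfl ih)

/-- **§3 main (LEMMA C).** `nv (Σ_{i ∈ s} Eᵢ · Fᵢ) ≤ 4 |s|` for `Eᵢ ∈ ℂ[x]`, `Fᵢ ∈ ℂ[y]`. -/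
theorem nv_sum_mul_le {ι : Type*} (s : Finset ι) (E F : ι → Poly2) (hE : ∀ i ∈ s, PureX (E i))
    (hF : ∀ i ∈ s, PureY (F i)) : nv (∑ i ∈ s, E i * F i) ≤ 4 * s.card := by
  classical
  set D := ∑ i ∈ s, E i * F i with hD
  have hrank : (coeffMatrix (boxSize D) D).rank ≤ s.card := by
    rw [hD, coeffMatrix_sum]
    refine (rank_sum_le _ _).trans ?_
    calc ∑ i ∈ s, (coeffMatrix (boxSize (∑ i ∈ s, E i * F i)) (E i * F i)).rank ≤ ∑ i ∈ s, 1 := by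
          refine Finset.sum_le_sum fun i hi => ?_
          rw [coeffMatrix_mul_of_pure _ (hE i hi) (hF i hi)]
          exact Matrix.rank_vecMulVec_le _ _
      _ = s.card := by simp
  exact (nv_le_four_mul_rank D (boxSize D) (inBox_boxSize D)).trans (by omega)

/-- **LEMMA C, fibred form.** If the `y`-factor depends only on `π x ∈ t`, then `nv ≤ 4 |t|`. -/
theorem nv_sum_mul_fiber_le {σ β : Type*} (s : Finset σ) (t : Finset β) (π : σ → β) (hπ : ∀ x ∈ s, π x ∈ t)
    (E : σ → Poly2) (F : β → Poly2) (hE : ∀ x ∈ s, PureX (E x)) (hF : ∀ b ∈ t, PureY (F b)) :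
    nv (∑ x ∈ s, E x * F (π x)) ≤ 4 * t.card := by
  classical
  have hre : ∑ x ∈ s, E x * F (π x) = ∑ b ∈ t, (∑ x ∈ s.filter (fun x => π x = b), E x) * F b := by
    rw [← Finset.sum_fiberwise_of_maps_to hπ]
    refine Finset.sum_congr rfl fun b hb => ?_
    rw [Finset.sum_mul]
    refine Finset.sum_congr rfl fun x hx => ?_
    rw [(Finset.mem_filter.1 hx).2]
  rw [hre]
  exact nv_sum_mul_le t _ F (fun b hb => noVar_sum _ _ fun x hx => hE x (Finset.mem_filter.1 hx).1) hF

end ProductForm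

/-! ## §4  Corollaries for `TwoProducts`-type tables and for the onset class of record

(a) rows that are sums of `|I_j|` products `E(x)F(y)` ⇒ `nv (∏ f − ∏ g) ≤ 4 (∏ |I_j| + ∏ |I'_j|)`;
(b) the `x`-projection form `nv (∏ f − ∏ g) ≤ 4 (∏_j #xdegs(f_j) + ∏_j #xdegs(g_j))`;
(c) DIGIT-GRID rows (`{0} ∪ A_s`, `A_s = {x^{2^a} y^{2^b} : a, b < s}`, `t − 1 = s²`): `nv ≤ 8 (s+1)^m`;
(d) AXIS rows `f_j = A_j(x) + B_j(y)`: `nv ≤ 2^{m+3}` (currency-true: `a = 1`, no `t`);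
(e)/(f) the ONSET CLASS OF RECORD (`RankThreeAffineLaw`, val-idea-35 g10) on an additively / multiplicatively
SEPARABLE carrier `H = A(x) + B(y)` / `A(x)·B(y)`: `nv (P(x, y, H)) ≤ 4 (m+1)²`, uniformly in `t`;
(g) the same in the `TwoProducts` table language (rows `b_j + a_{j0} x + a_{j1} y + a_{j2} H`). -/
section Corollaries

open MvPolynomial

/-- (a) General product form. -/
theorem nv_prod_sub_prod_le {ι κ : Type*} {m : ℕ} (I : Fin m → Finset ι) (J : Fin m → Finset κ)
    (E F : Fin m → ι → Poly2) (E' F' : Fin m → κ → Poly2)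
    (hE : ∀ j, ∀ i ∈ I j, PureX (E j i)) (hF : ∀ j, ∀ i ∈ I j, PureY (F j i))
    (hE' : ∀ j, ∀ i ∈ J j, PureX (E' j i)) (hF' : ∀ j, ∀ i ∈ J j, PureY (F' j i)) :
    nv (∏ j, (∑ i ∈ I j, E j i * F j i) - ∏ j, (∑ i ∈ J j, E' j i * F' j i))
      ≤ 4 * (∏ j, (I j).card + ∏ j, (J j).card) := by
  classical
  have h1 : ∏ j, (∑ i ∈ I j, E j i * F j i)
      = ∑ x ∈ Fintype.piFinset I, (∏ j, E j (x j)) * (∏ j, F j (x j)) := by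
    rw [Finset.prod_univ_sum]
    exact Finset.sum_congr rfl fun x _ => Finset.prod_mul_distrib
  have h2 : ∏ j, (∑ i ∈ J j, E' j i * F' j i)
      = ∑ y ∈ Fintype.piFinset J, (∏ j, E' j (y j)) * (∏ j, F' j (y j)) := by
    rw [Finset.prod_univ_sum]
    exact Finset.sum_congr rfl fun y _ => Finset.prod_mul_distrib
  set S := (Fintype.piFinset I).disjSum (Fintype.piFinset J) with hS
  set EE : ((j : Fin m) → ι) ⊕ ((j : Fin m) → κ) → Poly2 :=
    Sum.elim (fun x => ∏ j, E j (x j)) (fun y => -∏ j, E' j (y j)) with hEE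
  set FF : ((j : Fin m) → ι) ⊕ ((j : Fin m) → κ) → Poly2 :=
    Sum.elim (fun x => ∏ j, F j (x j)) (fun y => ∏ j, F' j (y j)) with hFF
  have h3 : ∏ j, (∑ i ∈ I j, E j i * F j i) - ∏ j, (∑ i ∈ J j, E' j i * F' j i) = ∑ z ∈ S, EE z * FF z := by
    rw [Finset.sum_disjSum, h1, h2, sub_eq_add_neg, ← Finset.sum_neg_distrib]
    simp [EE, FF, neg_mul]
  rw [h3]
  refine (nv_sum_mul_le S EE FF ?_ ?_).trans ?_
  · rintro (x | y) hz
    · have hx : x ∈ Fintype.piFinset I := Finset.inl_mem_disjSum.1 hz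
      simpa [EE] using noVar_prod _ _ fun j _ => hE j (x j) (Fintype.mem_piFinset.1 hx j)
    · have hy : y ∈ Fintype.piFinset J := Finset.inr_mem_disjSum.1 hz
      simpa [EE] using noVar_neg (noVar_prod _ _ fun j _ => hE' j (y j) (Fintype.mem_piFinset.1 hy j))
  · rintro (x | y) hz
    · have hx : x ∈ Fintype.piFinset I := Finset.inl_mem_disjSum.1 hz
      simpa [FF] using noVar_prod _ _ fun j _ => hF j (x j) (Fintype.mem_piFinset.1 hx j)
    · have hy : y ∈ Fintype.piFinset J := Finset.inr_mem_disjSum.1 hz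
      simpa [FF] using noVar_prod _ _ fun j _ => hF' j (y j) (Fintype.mem_piFinset.1 hy j)
  · rw [hS, Finset.card_disjSum, Fintype.card_piFinset, Fintype.card_piFinset]

/-- The set of `x`-degrees of `f`. -/
noncomputable def xdegs (f : Poly2) : Finset ℕ := f.support.image fun e => e 0

/-- The `y`-column of `f` at `x`-degree `p`. -/
noncomputable def xcol (f : Poly2) (p : ℕ) : Poly2 :=
  ∑ e ∈ f.support.filter (fun e => e 0 = p), monomial (Finsupp.single 1 (e 1)) (coeff e f)

theorem noVar_monomial {i : Fin 2} {n : Expo} (hn : n i = 0) (c : ℂ) : NoVar i (monomial n c : Poly2) := by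
  intro e he
  rw [coeff_monomial]
  split_ifs with h
  · subst h; exact absurd hn he
  · rfl

theorem pureY_xcol (f : Poly2) (p : ℕ) : PureY (xcol f p) :=
  noVar_sum _ _ fun e _ => noVar_monomial (by simp) _

theorem pureX_X_pow (p : ℕ) : PureX ((X 0 : Poly2) ^ p) := noVar_pow (noVar_X (by decide)) p

theorem pureY_X_pow (q : ℕ) : PureY ((X 1 : Poly2) ^ q) := noVar_pow (noVar_X (by decide)) q

/-- Row decomposition `f = Σ_{p ∈ xdegs f} x^p · xcol f p`. -/
theorem eq_sum_xcol (f : Poly2) : f = ∑ p ∈ xdegs f, (X 0 : Poly2) ^ p * xcol f p := by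
  classical
  conv_lhs => rw [f.as_sum]
  rw [← Finset.sum_fiberwise_of_maps_to (s := f.support) (t := xdegs f) (g := fun e : Expo => e 0)
    (fun e he => Finset.mem_image_of_mem _ he)]
  refine Finset.sum_congr rfl fun p hp => ?_
  rw [xcol, Finset.mul_sum]
  refine Finset.sum_congr rfl fun e he => ?_
  rw [X_pow_eq_monomial, monomial_mul, one_mul, ← (Finset.mem_filter.1 he).2, ← expo_eq e]

/-- (b) `x`-projection form. -/
theorem nv_prod_sub_prod_le_xdegs {m : ℕ} (f g : Fin m → Poly2) :
    nv (∏ j, f j - ∏ j, g j) ≤ 4 * (∏ j, (xdegs (f j)).card + ∏ j, (xdegs (g j)).card) := by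
  have hf : ∏ j, f j = ∏ j, (∑ p ∈ xdegs (f j), (X 0 : Poly2) ^ p * xcol (f j) p) :=
    Finset.prod_congr rfl fun j _ => eq_sum_xcol (f j)
  have hg : ∏ j, g j = ∏ j, (∑ p ∈ xdegs (g j), (X 0 : Poly2) ^ p * xcol (g j) p) :=
    Finset.prod_congr rfl fun j _ => eq_sum_xcol (g j)
  rw [hf, hg]
  exact nv_prod_sub_prod_le (fun j => xdegs (f j)) (fun j => xdegs (g j)) (fun j p => (X 0 : Poly2) ^ p)
    (fun j p => xcol (f j) p) (fun j p => (X 0 : Poly2) ^ p) (fun j p => xcol (g j) p)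
    (fun j p _ => pureX_X_pow p) (fun j p _ => pureY_xcol _ p) (fun j p _ => pureX_X_pow p)
    (fun j p _ => pureY_xcol _ p)

/-- (b') rows with at most `r` distinct `x`-degrees: `nv ≤ 8 r^m`. -/
theorem nv_prod_sub_prod_le_of_xdegs_le {m r : ℕ} (f g : Fin m → Poly2) (hf : ∀ j, (xdegs (f j)).card ≤ r)
    (hg : ∀ j, (xdegs (g j)).card ≤ r) : nv (∏ j, f j - ∏ j, g j) ≤ 8 * r ^ m := by
  have h1 : ∏ j, (xdegs (f j)).card ≤ r ^ m := by
    have := Finset.prod_le_pow_card Finset.univ (fun j : Fin m => (xdegs (f j)).card) r fun j _ => hf j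
    simpa using this
  have h2 : ∏ j, (xdegs (g j)).card ≤ r ^ m := by
    have := Finset.prod_le_pow_card Finset.univ (fun j : Fin m => (xdegs (g j)).card) r fun j _ => hg j
    simpa using this
  exact (nv_prod_sub_prod_le_xdegs f g).trans (by omega)

/-- Rows supported on the DIGIT GRID `{0} ∪ A_s`, `A_s = {x^{2^a} y^{2^b} : a, b < s}` (`t − 1 = s²`). -/
def OnDigitGrid (s : ℕ) (f : Poly2) : Prop :=
  ∀ e ∈ f.support, e = 0 ∨ ∃ a, a < s ∧ ∃ b, b < s ∧ e = bx (2 ^ a) (2 ^ b)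

theorem card_xdegs_le_of_onDigitGrid {s : ℕ} {f : Poly2} (h : OnDigitGrid s f) : (xdegs f).card ≤ s + 1 := by
  classical
  have hsub : xdegs f ⊆ insert 0 ((Finset.range s).image fun a => 2 ^ a) := by
    intro p hp
    obtain ⟨e, he, rfl⟩ := Finset.mem_image.1 hp
    rcases h e he with rfl | ⟨a, ha, b, hb, rfl⟩
    · simp
    · exact Finset.mem_insert_of_mem (Finset.mem_image.2 ⟨a, Finset.mem_range.2 ha, by simp⟩)
  calc (xdegs f).card ≤ (insert 0 ((Finset.range s).image fun a => 2 ^ a)).card := Finset.card_le_card hsub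
    _ ≤ ((Finset.range s).image fun a => 2 ^ a).card + 1 := Finset.card_insert_le _ _
    _ ≤ (Finset.range s).card + 1 := Nat.succ_le_succ Finset.card_image_le
    _ = s + 1 := by simp

/-- (c) DIGIT-GRID ROWS: `nv (∏ f − ∏ g) ≤ 8 (s+1)^m` — i.e. `O(t^{m/2})` vertices on the digit grid with
`t − 1 = s²`, versus the KPTT bound `O(t^{2m/3})`; NOT in the `TwoProducts` currency `2^{am}(t+2)^b`. -/
theorem nv_twoProducts_digitGrid_le {m s : ℕ} (f g : Fin m → Poly2) (hf : ∀ j, OnDigitGrid s (f j))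
    (hg : ∀ j, OnDigitGrid s (g j)) : nv (∏ j, f j - ∏ j, g j) ≤ 8 * (s + 1) ^ m :=
  nv_prod_sub_prod_le_of_xdegs_le f g (fun j => card_xdegs_le_of_onDigitGrid (hf j))
    (fun j => card_xdegs_le_of_onDigitGrid (hg j))

/-- (d) AXIS ROWS `f_j = A_j(x) + B_j(y)`: `nv (∏ f − ∏ g) ≤ 2^{m+3}` (currency-true, `t`-free). -/
theorem nv_twoProducts_axisRows_le {m : ℕ} (A B A' B' : Fin m → Poly2) (hA : ∀ j, PureX (A j))
    (hB : ∀ j, PureY (B j)) (hA' : ∀ j, PureX (A' j)) (hB' : ∀ j, PureY (B' j)) :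
    nv (∏ j, (A j + B j) - ∏ j, (A' j + B' j)) ≤ 2 ^ (m + 3) := by
  classical
  let E : Fin m → Bool → Poly2 := fun j c => if c then A j else 1
  let F : Fin m → Bool → Poly2 := fun j c => if c then 1 else B j
  let E' : Fin m → Bool → Poly2 := fun j c => if c then A' j else 1
  let F' : Fin m → Bool → Poly2 := fun j c => if c then 1 else B' j
  have hf : ∏ j, (A j + B j) = ∏ j, (∑ c ∈ (Finset.univ : Finset Bool), E j c * F j c) :=
    Finset.prod_congr rfl fun j _ => by simp [E, F]
  have hg : ∏ j, (A' j + B' j) = ∏ j, (∑ c ∈ (Finset.univ : Finset Bool), E' j c * F' j c) :=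
    Finset.prod_congr rfl fun j _ => by simp [E', F']
  rw [hf, hg]
  refine (nv_prod_sub_prod_le (fun _ => Finset.univ) (fun _ => Finset.univ) E F E' F' ?_ ?_ ?_ ?_).trans ?_
  · rintro j (_ | _) - <;> simp [E, hA j, noVar_one]
  · rintro j (_ | _) - <;> simp [F, hB j, noVar_one]
  · rintro j (_ | _) - <;> simp [E', hA' j, noVar_one]
  · rintro j (_ | _) - <;> simp [F', hB' j, noVar_one]
  · simp only [Finset.card_univ, Fintype.card_bool, Finset.prod_const, Fintype.card_fin]
    rw [pow_add]; omega

theorem le_of_mem_support_of_totalDegree_le {m : ℕ} {P : Poly3} (hP : P.totalDegree ≤ m) {d : Fin 3 →₀ ℕ}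
    (hd : d ∈ P.support) (i : Fin 3) : d i ≤ m :=
  (monomial_le_degreeOf i hd).trans ((degreeOf_le_totalDegree P i).trans hP)

theorem aeval_eq_sum_three (w : Fin 3 → Poly2) (P : Poly3) :
    aeval w P = ∑ d ∈ P.support, C (coeff d P) * (w 0 ^ (d 0) * w 1 ^ (d 1) * w 2 ^ (d 2)) := by
  rw [MvPolynomial.aeval_def, MvPolynomial.eval₂_eq']
  refine Finset.sum_congr rfl fun d _ => ?_
  rw [Fin.prod_univ_three, MvPolynomial.algebraMap_eq]

/-- (e) ONSET CLASS, additively separable carrier `H = A(x) + B(y)`: `nv (P(x, y, H)) ≤ 4 (m+1)²` for every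
`P` of total degree `≤ m` — uniformly in the sparsity of `A`, `B`. -/
theorem nv_onset_addSep_le (m : ℕ) (P : Poly3) (A B : Poly2) (hP : P.totalDegree ≤ m) (hA : PureX A)
    (hB : PureY B) :
    nv (aeval (![X 0, X 1, A + B] : Fin 3 → Poly2) P) ≤ 4 * (m + 1) ^ 2 := by
  classical
  have hexp : aeval (![X 0, X 1, A + B] : Fin 3 → Poly2) P
      = ∑ x ∈ P.support.sigma (fun d => Finset.range (d 2 + 1)),
          (C (coeff x.1 P) * C (((x.1 2).choose x.2 : ℕ) : ℂ) * X 0 ^ (x.1 0) * A ^ x.2)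
            * ((X 1 : Poly2) ^ (x.1 1) * B ^ (x.1 2 - x.2)) := by
    rw [aeval_eq_sum_three, Finset.sum_sigma]
    refine Finset.sum_congr rfl fun d _ => ?_
    simp only [Matrix.cons_val_zero, Matrix.cons_val_one, Matrix.cons_val_two, Matrix.head_cons,
      Matrix.tail_cons]
    rw [add_pow, Finset.mul_sum, Finset.mul_sum]
    refine Finset.sum_congr rfl fun k _ => ?_
    rw [← map_natCast (C : ℂ →+* Poly2)]
    ring
  rw [hexp]
  refine (nv_sum_mul_fiber_le (P.support.sigma fun d => Finset.range (d 2 + 1))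
    (Finset.range (m + 1) ×ˢ Finset.range (m + 1)) (fun x => (x.1 1, x.1 2 - x.2)) ?_
    (fun x => C (coeff x.1 P) * C (((x.1 2).choose x.2 : ℕ) : ℂ) * X 0 ^ (x.1 0) * A ^ x.2)
    (fun bc => (X 1 : Poly2) ^ bc.1 * B ^ bc.2) ?_ ?_).trans ?_
  · rintro ⟨d, k⟩ hx
    obtain ⟨hd, hk⟩ := Finset.mem_sigma.1 hx
    have h1 : d 1 ≤ m := le_of_mem_support_of_totalDegree_le hP hd 1
    have h2 : d 2 ≤ m := le_of_mem_support_of_totalDegree_le hP hd 2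
    have hk' : k < d 2 + 1 := Finset.mem_range.1 hk
    simp only [Finset.mem_product, Finset.mem_range]
    omega
  · rintro ⟨d, k⟩ -
    exact noVar_mul (noVar_mul (noVar_mul (noVar_C _ _) (noVar_C _ _)) (pureX_X_pow _)) (noVar_pow hA _)
  · rintro ⟨b, c⟩ -
    exact noVar_mul (pureY_X_pow _) (noVar_pow hB _)
  · rw [Finset.card_product, Finset.card_range]
    exact le_of_eq (by ring)

/-- (f) ONSET CLASS, multiplicatively separable carrier `H = A(x) · B(y)`: `nv (P(x, y, H)) ≤ 4 (m+1)²`. -/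
theorem nv_onset_mulSep_le (m : ℕ) (P : Poly3) (A B : Poly2) (hP : P.totalDegree ≤ m) (hA : PureX A)
    (hB : PureY B) :
    nv (aeval (![X 0, X 1, A * B] : Fin 3 → Poly2) P) ≤ 4 * (m + 1) ^ 2 := by
  classical
  have hexp : aeval (![X 0, X 1, A * B] : Fin 3 → Poly2) P
      = ∑ d ∈ P.support, (C (coeff d P) * X 0 ^ (d 0) * A ^ (d 2)) * ((X 1 : Poly2) ^ (d 1) * B ^ (d 2)) := by
    rw [aeval_eq_sum_three]
    refine Finset.sum_congr rfl fun d _ => ?_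
    simp only [Matrix.cons_val_zero, Matrix.cons_val_one, Matrix.cons_val_two, Matrix.head_cons,
      Matrix.tail_cons]
    rw [mul_pow]
    ring
  rw [hexp]
  refine (nv_sum_mul_fiber_le P.support (Finset.range (m + 1) ×ˢ Finset.range (m + 1))
    (fun d => (d 1, d 2)) ?_ (fun d => C (coeff d P) * X 0 ^ (d 0) * A ^ (d 2))
    (fun bc => (X 1 : Poly2) ^ bc.1 * B ^ bc.2) ?_ ?_).trans ?_
  · intro d hd
    have h1 : d 1 ≤ m := le_of_mem_support_of_totalDegree_le hP hd 1
    have h2 : d 2 ≤ m := le_of_mem_support_of_totalDegree_le hP hd 2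
    simp only [Finset.mem_product, Finset.mem_range]
    omega
  · intro d _
    exact noVar_mul (noVar_mul (noVar_C _ _) (pureX_X_pow _)) (noVar_pow hA _)
  · rintro ⟨b, c⟩ -
    exact noVar_mul (pureY_X_pow _) (noVar_pow hB _)
  · rw [Finset.card_product, Finset.card_range]
    exact le_of_eq (by ring)

theorem aeval_affForm (w : Fin 3 → Poly2) (b : ℂ) (a : Fin 3 → ℂ) :
    aeval w (C b + ∑ i : Fin 3, a i • X i : Poly3) = C b + ∑ i : Fin 3, a i • w i := by
  simp [map_add, map_sum, MvPolynomial.algebraMap_eq]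

theorem totalDegree_affForm_le (b : ℂ) (a : Fin 3 → ℂ) :
    (C b + ∑ i : Fin 3, a i • X i : Poly3).totalDegree ≤ 1 := by
  refine (totalDegree_add _ _).trans (max_le (by simp) ?_)
  refine (totalDegree_finsetSum _ _).trans (Finset.sup_le fun i _ => ?_)
  refine (totalDegree_smul_le _ _).trans ?_
  simp [totalDegree_X]

theorem totalDegree_prodAff_le (m : ℕ) (b : Fin m → ℂ) (a : Fin m → Fin 3 → ℂ) :
    (∏ j : Fin m, (C (b j) + ∑ i : Fin 3, a j i • X i) : Poly3).totalDegree ≤ m := by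
  refine (totalDegree_finsetProd _ _).trans ?_
  calc ∑ j : Fin m, (C (b j) + ∑ i : Fin 3, a j i • X i : Poly3).totalDegree
      ≤ ∑ _j : Fin m, 1 := Finset.sum_le_sum fun j _ => totalDegree_affForm_le (b j) (a j)
    _ = m := by simp

/-- (g) The `TwoProducts` ONSET CLASS (rows affine in `x, y, H`) with an additively separable carrier
`H = A(x) + B(y)`: `nv (∏ f − ∏ g) ≤ 4 (m+1)²`, uniformly in `t`.  This DECIDES `RankThreeAffineLaw` /
`TwoProductsAffRankThree` (val-idea-35 g10) on the sub-class `{w₀ = x, w₁ = y, w₂ separable}`. -/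
theorem nv_twoProducts_onset_addSep_le {m : ℕ} (A B : Poly2) (hA : PureX A) (hB : PureY B)
    (b b' : Fin m → ℂ) (a a' : Fin m → Fin 3 → ℂ) :
    nv (∏ j, (C (b j) + ∑ i, a j i • (![X 0, X 1, A + B] : Fin 3 → Poly2) i)
        - ∏ j, (C (b' j) + ∑ i, a' j i • (![X 0, X 1, A + B] : Fin 3 → Poly2) i)) ≤ 4 * (m + 1) ^ 2 := by
  classical
  set w : Fin 3 → Poly2 := ![X 0, X 1, A + B] with hw
  set P : Poly3 := ∏ j, (C (b j) + ∑ i : Fin 3, a j i • X i) - ∏ j, (C (b' j) + ∑ i : Fin 3, a' j i • X i)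
    with hPdef
  have hPm : P.totalDegree ≤ m :=
    (totalDegree_sub _ _).trans (max_le (totalDegree_prodAff_le m b a) (totalDegree_prodAff_le m b' a'))
  have haeval : aeval w P = ∏ j, (C (b j) + ∑ i, a j i • w i) - ∏ j, (C (b' j) + ∑ i, a' j i • w i) := by
    rw [hPdef, map_sub, map_prod, map_prod]
    simp only [aeval_affForm]
  rw [← haeval, hw]
  exact nv_onset_addSep_le m P A B hPm hA hB

/-- (h) In the quantifier shape of `RankThreeAffineLaw` (val-idea-35 g10, `∃ c, ∀ m t P w, … ≤ (m+2)^c (t+2)^c`),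
restricted to the separable carriers: the law HOLDS with `c = 2` (and no dependence on `t` at all). -/
theorem rankThreeAffineLaw_addSep :
    ∃ c : ℕ, ∀ (m t : ℕ) (P : Poly3) (A B : Poly2), P.totalDegree ≤ m → PureX A → PureY B →
      nv (aeval (![X 0, X 1, A + B] : Fin 3 → Poly2) P) ≤ (m + 2) ^ c * (t + 2) ^ c := by
  refine ⟨2, fun m t P A B hP hA hB => (nv_onset_addSep_le m P A B hP hA hB).trans ?_⟩
  have h4 : 2 ^ 2 ≤ (t + 2) ^ 2 := Nat.pow_le_pow_left (by omega) 2
  have hm : (m + 1) ^ 2 ≤ (m + 2) ^ 2 := Nat.pow_le_pow_left (by omega) 2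
  calc 4 * (m + 1) ^ 2 ≤ (t + 2) ^ 2 * (m + 2) ^ 2 := Nat.mul_le_mul h4 hm
    _ = (m + 2) ^ 2 * (t + 2) ^ 2 := mul_comm _ _

end Corollaries

/-! ## §5  Status, dictionary, and what is NOT proved (honest frame)

* PROVED here (kernel, axioms `propext`/`Classical.choice`/`Quot.sound` only):
  the RANK LEMMA `nv_le_four_mul_rank` (every `D ∈ ℂ[x,y]`), LEMMA C `nv_sum_mul_le` / `nv_sum_mul_fiber_le`,
  and the corollaries (a)–(h) above.  The invariant is the SEPARATION RANK `rank (coeff x^p y^q D)_{p,q}`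
  (= the tensor rank of `D` in `ℂ[x] ⊗ ℂ[y]`): it is blind to the sparsity `t`, subadditive, `≤ 1` on products
  `E(x)F(y)`, and invariant under reindexing rows/columns — which is why it survives the TWO shift directions
  `x`, `y` of the onset class (director b151 wave-4 brief) where record/carrier laws (one shift) died (g0–g12).
* (e)–(h) DECIDE the open address of record `RankThreeAffineLaw` / `TwoProductsAffRankThree` (val-idea-35 g10,
  `Cruxes/TwoProducts/RankThreeWronskian_val_idea_35_g10.lean` §OnsetGamma) on the sub-class of SEPARABLE carriers
  `w₂ = A(x) + B(y)` or `A(x)·B(y)` (more generally separation rank `r`: `nv ≤ 4 r (m+1)^{…}`, same proof), with a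
  `t`-FREE bound.  The generic carrier `H` of separation rank `s` on the digit grid `A_s` is NOT decided: the rank
  lemma gives only `8 (s+1)^m` there ((c)), i.e. `O(t^{m/2})` — better than KPTT's `t^{2m/3}` on that family but
  exponential in `m`, hence NOT in the `TwoProducts` currency `2^{am} (t+2)^b`.
* NOT proved: `TwoProducts` (5906), `RankThreeAffineLaw` in general, anything about `closes`; VP ≠ VNP is NOT
  proved.  Distance moved on 5906: one named sub-class of the onset class settled; the residual is precisely the
  full-separation-rank digit-grid carrier (see the memo `RankLemma-val-idea-34-g13.md` §3 for the envelope /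
  top-resonance reduction of that residual to the closed lower-left quadrant of directions). -/


end Summit.ValiantsHypothesis.ValiantsHypothesis.Cruxes.TwoProducts.ValIdea34g13
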